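import Summits.QuantumFields.BalabanUV.Beta.EriceFlowEnclosureB12AsPrintedHistoryContagionShiftFlowZeroTangentCocycle
import Mathlib.Analysis.SpecialFunctions.Log.Summable

/-!
# Beta / EriceFlowEnclosureB12AsPrintedHistoryContagionShiftFlowZeroTangentProduct — ASYMPTOTIC FREEDOM IS CONTAGIOUS, part 76: THE TANGENT FLOW IS A PRODUCT OF ONE-STEP
# TANGENT FACTORS; THE DISCRETE GELL-MANN–LOW FORMULA.  FOR THE FLOW (part 14's package at e′, the gradient profile `hG` of part 68): (§130) the ONE-STEP TANGENT FACTOR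
# `ω(x) := Ŵ_1(x)` — the tangent flow at the pin x read at the first ultraviolet scale, i.e. the derivative of the one-step chart map `1∕x² ↦ 1∕h_1(x)²` (part 69) — obeys the
# CUBE LAW **`|ω(x) − 1| ≤ 8C_m x³∕(1−θ)`** (row 0 of part 66's kernel at the pin's own base: the first row is charged to the youngest AF weight `(1∕(4x²) + β*∕4)^{−3∕2} ≤ 8x³`),
# against `|W_k(x) − 1| = O(x)` for the whole flow (part 68); (§131) a TANGENT FIELD (the tangent flow chosen at every pin of ]0, e′] — it EXISTS by part 68 and choice and is
# UNIQUE by part 68) satisfies the **PRODUCT FORMULA `W_k(e) = Π_{i<k} ω(h_i(e))`** for `2e ≤ e′` (part 75's cocycle `W_{k+1}(e) = W_k(e)·Ŵ_1(h_k e)` iterated along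
# `solution_tail`), each factor deviating from 1 by at most `C_m w_{i+1}(e)∕(1−θ)` with e's OWN AF weights (the factor at `h_i(e)` is row i of the kernel at base 2e); (§132) hence
# `Σ_i |ω(h_i e) − 1| ≤ C_m(8e³ + 16e∕β*)∕(1−θ) < ∞`, the **INFINITE PRODUCT `W_∞(e) = Π_{i≥0} ω(h_i(e))`** converges (`HasProd`, Mathlib's `multipliable_one_add_of_summable`) to
# part 70's ultraviolet limit of the tangent flow, and for every dynamical Abel function Λ (part 44's interface, the C¹ letters `hG`, `hGB`): the **DISCRETE GELL-MANN–LOW FORMULA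
# `Λ′(e) = −(2∕e³)·Π_{i≥0} ω(h_i(e))`**, equivalently **`β_c(e) := β₀∕Λ′(e) = −(β₀e³∕2)·(Π_{i≥0} ω(h_i(e)))⁻¹`** — the continuum β-function of parts 60 ∕ 72 at coupling e is
# the bare one-loop value corrected by the product of the one-step tangent factors along the whole ultraviolet trajectory issued from e
# (β-flow team, prover 1, unit `b2b-balaban-beta-bflow-p1`, gen 43; ROW AP-I·Uc × NODE U2)

HONEST FRAMING (page 1 of everything the β sub-cell writes): discharging `BetaPertH` makes Bałaban's UV stability UNCONDITIONAL — a
real constructive-QFT result; it is NOT the continuum limit and NOT the Clay problem.  HONEST DEPENDENCY (cell reorg 2026-08-19,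
verbatim): «continuum YM on T⁴ ⇐ BetaPertH ∧ nine spine estimates (0/9 proved); BetaPertH ⇐ (D1) ∧ (D4) ∧ CAP+tail; G-an2-4 gates
asym, D1 and NE2/3/4.»  THIS MODULE DISCHARGES NOTHING: [folklore] bookkeeping (row 0 of part 66's kernel, induction on the scale over part 75's cocycle, comparison of a
non-negative series with the AF weights, Mathlib's `multipliable_one_add_of_summable` and uniqueness of limits) over node U2's HYPOTHESIS SHAPES `T4BetaStationary.{SeqBox,
MemoryProfile}`, `T4BetaFlowWellPosed.{MemFlow, solution, seqBox_shift}`, `T4CouplingMatching.{sprof, sprof_zero}` and parts 42, 66, 67, 68, 70, 75 of this series, all BY NAME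
(NOT PRINTED for [I] = T. Bałaban, Commun. Math. Phys. **109** (1987) [Balaban1987RG1]: p. 298 says only that β_j depends on the preceding couplings; (0.20) p. 256; Theorem 2
(0.31) p. 259 STATED WITHOUT PROOF; a derivative of the coupling flow in its datum is printed nowhere in [I]).  The C¹ shape (`hG`, `hGB`) and the tangent field are explicit
binders.  «One-step tangent factor», «discrete Gell-Mann–Low», «β_c» are OUR READING (physics analogues; nothing imported).  Nothing of Bałaban's β is asserted.

WHAT THIS FILE PROVES (0 sorry, 0 def): §130 **`tangent_one_sub_one_abs_le`** (the cube law), `tangent_one_mem_Icc`; §131 `tangentField_exists`, `tangentField_eq`,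
**`tangentField_eq_prod`** (the product formula), **`tangentField_one_sub_one_abs_le`** (factor i against e's weights); §132 **`hasProd_tangentField`** (summable deviations,
`Multipliable`, `HasProd … W_∞`, `W_∞ = ∏'`), **`deriv_dynAbel_eq_tprod`** (discrete Gell-Mann–Low), `betaFunction_eq_tprod`.  NOT CLAIMED: differentiability of the factors in
the pin (parts 77–80); anything about Bałaban's β; `BetaPertH`; the continuum limit of the measures; Clay.
-/

namespace Summit.QuantumFields.BalabanUV.Beta.EriceFlowEnclosureB12AsPrintedHistoryContagionShiftFlowZeroTangentProduct

open Finset Filter Topology Set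
open Literature.MathematicalPhysics.QuantumFieldTheory.Balaban1983to89
open Literature.MathematicalPhysics.QuantumFieldTheory.Balaban1983to89.T4CouplingMatching (sprof sprof_zero)
open Literature.MathematicalPhysics.QuantumFieldTheory.Balaban1983to89.T4BetaStationary (SeqBox MemoryProfile)
open Literature.MathematicalPhysics.QuantumFieldTheory.Balaban1983to89.T4BetaFlowWellPosed (MemFlow solution seqBox_shift)
open Summit.QuantumFields.BalabanUV.Beta.EriceFlowEnclosureB12AsPrintedHistoryContagionShiftFlowZeroOffset (package_of_le)
open Summit.QuantumFields.BalabanUV.Beta.EriceFlowEnclosureB12AsPrintedHistoryContagionShiftFlowZeroTangent (row_summable_abs_le abs_term_le)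
open Summit.QuantumFields.BalabanUV.Beta.EriceFlowEnclosureB12AsPrintedHistoryContagionShiftFlowZeroTangentLimit (profWeight_nonneg profWeight_anti
  sum_profWeight_succ_le)
open Summit.QuantumFields.BalabanUV.Beta.EriceFlowEnclosureB12AsPrintedHistoryContagionShiftFlowZeroTangentFlow (solution_facts tangent_data tangent_exists tangent_unique
  tangent_sub_one_abs_le)
open Summit.QuantumFields.BalabanUV.Beta.EriceFlowEnclosureB12AsPrintedHistoryContagionShiftFlowZeroTangentLambda (tangentLimit_exists deriv_dynAbel_eq)
open Summit.QuantumFields.BalabanUV.Beta.EriceFlowEnclosureB12AsPrintedHistoryContagionShiftFlowZeroTangentCocycle (solution_tail_of_le_half tangent_cocycle)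

noncomputable section

/-! ## §130 The one-step tangent factor and its cube law -/

/-- **THE CUBE LAW OF THE ONE-STEP TANGENT FACTOR.**  Part 14's package at e′, the gradient profile `hG`, `e ∈ ]0, e′]`, W the tangent flow at e (its equation + `|W| ≤ 2`).
THEN the factor at the first ultraviolet scale satisfies **`|W_1 − 1| ≤ C_m·w_1(e)∕(1−θ) ≤ 8C_m e³∕(1−θ)`**, `w_q(e) = (1∕(4e²) + (β*∕4)q)^{−3∕2}` the AF weight at the pin's own
base (row 0 of part 66's kernel: `W_1 − 1 = −Σ_j G(h_{1+·}) j (h_{1+j}³∕2) W_{1+j}`, the whole fading row charged to the youngest weight `w_1 ≤ w_0 = 8e³`).  The one-step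
tangent factor deviates from 1 at THIRD order in the coupling, the whole tangent flow at first order (part 68's `|W_k − 1| ≤ C_m(8e³ + 16e∕β*)∕(1−θ)`).
[cite: Balaban1987RG1, Thm 2 (0.31) p.259 with (0.20) p.256 and p.298] -/
theorem tangent_one_sub_one_abs_le {B : (ℕ → ℝ) → ℝ} {G : (ℕ → ℝ) → ℕ → ℝ} {Cm θ γ bs ta gs e' : ℝ} {t W : ℕ → ℝ}
    (hB : MemoryProfile Cm θ γ B) (hCm : 0 ≤ Cm) (hθ0 : 0 ≤ θ) (hθ1 : θ < 1) (hbs : 0 < bs) (hta : 0 < ta)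
    (hts : SeqBox γ t) (htf : MemFlow B gs t) (hprof : ∀ m : ℕ, 1 / ta ^ 2 + bs * (m : ℝ) ≤ 1 / (t m) ^ 2)
    (hG : ∀ u : ℕ → ℝ, SeqBox γ u → ∀ j, |G u j| ≤ Cm * θ ^ j)
    (h2e' : 2 * e' ≤ γ) (hs1 : 4 * Cm * e' ≤ bs * (1 - θ))
    (hs2 : e' ^ 2 * (1 / gs ^ 2 + Cm * γ / (1 - θ) ^ 2 + (2 * Cm / ((1 - θ) * bs)) ^ 2) ≤ 3 / 4)
    (hs4 : 64 * Cm * e' ^ 3 ≤ (1 - θ) ^ 2) (hs5 : Cm * (8 * e' ^ 3 + 16 * e' / bs) ≤ (1 - θ) / 4) {e : ℝ} (he : e ∈ Ioc (0 : ℝ) e')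
    (hW : ∀ k, W k = 1 - ∑ p ∈ range k, ∑' j, G (fun i => solution B e (p + 1 + i)) j * ((solution B e (p + 1 + j)) ^ 3 / 2) * W (p + 1 + j))
    (hWM : ∀ k, |W k| ≤ 2) :
    |W 1 - 1| ≤ Cm * (1 / (sprof (2 * e) (bs / 4) 1) ^ 2 * (1 / sprof (2 * e) (bs / 4) 1)) / (1 - θ) ∧
      |W 1 - 1| ≤ 8 * Cm * e ^ 3 / (1 - θ) := by
  have h1θ : 0 < 1 - θ := by linarith
  have hγ : 0 ≤ γ := by linarith [he.1, he.2]
  -- the package at the pin e itself: the solution is below the AF profile at base 2e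
  obtain ⟨hs1e, hs2e, hs4e, hs5e⟩ := package_of_le (gs := gs) hCm hθ1 hbs hγ he.1 he.2 hs1 hs2 hs4 hs5
  have hee : e ∈ Ioc (0 : ℝ) e := ⟨he.1, le_rfl⟩
  have h2e : 2 * e ≤ γ := by linarith [he.2]
  obtain ⟨hsb, -, -, -, -, hcube⟩ := solution_facts hB hCm hθ0 hθ1 hbs hta hts htf hprof h2e hs1e hs2e hs4e hs5e hee
  obtain ⟨hc, hv⟩ := tangent_data (B := B) (e' := e) hG hsb hcube
  have hrow := (row_summable_abs_le hθ0 hθ1 (fun hab => profWeight_anti hbs he.1 hab) (by norm_num : (0 : ℝ) ≤ 2 / 2) hCm 0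
    (abs_term_le hCm hθ0 hc hv hWM 0)).2
  have e1 : W 1 - 1 = -∑' j, G (fun i => solution B e (0 + 1 + i)) j * ((solution B e (0 + 1 + j)) ^ 3 / 2) * W (0 + 1 + j) := by
    rw [hW 1, Finset.sum_range_one]; ring
  rw [e1, abs_neg]
  have hw1 : Cm * (1 / (sprof (2 * e) (bs / 4) (0 + 1)) ^ 2 * (1 / sprof (2 * e) (bs / 4) (0 + 1)) * (2 / 2)) / (1 - θ)
      = Cm * (1 / (sprof (2 * e) (bs / 4) 1) ^ 2 * (1 / sprof (2 * e) (bs / 4) 1)) / (1 - θ) := by norm_num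
  rw [hw1] at hrow
  refine ⟨hrow, hrow.trans (div_le_div_of_nonneg_right ?_ h1θ.le)⟩
  have h2e0 : (0 : ℝ) < 2 * e := by have := he.1; positivity
  have h0 : 1 / (sprof (2 * e) (bs / 4) 0) ^ 2 * (1 / sprof (2 * e) (bs / 4) 0) = 8 * e ^ 3 := by
    rw [sprof_zero h2e0]; simp only [one_div_pow, one_div_one_div]; ring
  have hw10 : 1 / (sprof (2 * e) (bs / 4) 1) ^ 2 * (1 / sprof (2 * e) (bs / 4) 1) ≤ 8 * e ^ 3 := by
    have h := profWeight_anti hbs he.1 (Nat.zero_le 1); linarith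
  calc Cm * (1 / (sprof (2 * e) (bs / 4) 1) ^ 2 * (1 / sprof (2 * e) (bs / 4) 1)) ≤ Cm * (8 * e ^ 3) := mul_le_mul_of_nonneg_left hw10 hCm
    _ = 8 * Cm * e ^ 3 := by ring

/-- The one-step tangent factor lies in `[3∕4, 5∕4]` and is positive (part 68 at scale 1); with the cube law: `ω(e) ∈ [1 − 8C_m e³∕(1−θ), 1 + 8C_m e³∕(1−θ)]`.
[cite: Balaban1987RG1, Thm 2 (0.31) p.259 with (0.20) p.256] -/
theorem tangent_one_mem_Icc {B : (ℕ → ℝ) → ℝ} {G : (ℕ → ℝ) → ℕ → ℝ} {Cm θ γ bs ta gs e' : ℝ} {t W : ℕ → ℝ}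
    (hB : MemoryProfile Cm θ γ B) (hCm : 0 ≤ Cm) (hθ0 : 0 ≤ θ) (hθ1 : θ < 1) (hbs : 0 < bs) (hta : 0 < ta)
    (hts : SeqBox γ t) (htf : MemFlow B gs t) (hprof : ∀ m : ℕ, 1 / ta ^ 2 + bs * (m : ℝ) ≤ 1 / (t m) ^ 2)
    (hG : ∀ u : ℕ → ℝ, SeqBox γ u → ∀ j, |G u j| ≤ Cm * θ ^ j)
    (h2e' : 2 * e' ≤ γ) (hs1 : 4 * Cm * e' ≤ bs * (1 - θ))
    (hs2 : e' ^ 2 * (1 / gs ^ 2 + Cm * γ / (1 - θ) ^ 2 + (2 * Cm / ((1 - θ) * bs)) ^ 2) ≤ 3 / 4)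
    (hs4 : 64 * Cm * e' ^ 3 ≤ (1 - θ) ^ 2) (hs5 : Cm * (8 * e' ^ 3 + 16 * e' / bs) ≤ (1 - θ) / 4) {e : ℝ} (he : e ∈ Ioc (0 : ℝ) e')
    (hW : ∀ k, W k = 1 - ∑ p ∈ range k, ∑' j, G (fun i => solution B e (p + 1 + i)) j * ((solution B e (p + 1 + j)) ^ 3 / 2) * W (p + 1 + j))
    (hWM : ∀ k, |W k| ≤ 2) :
    W 1 ∈ Set.Icc (1 - 8 * Cm * e ^ 3 / (1 - θ)) (1 + 8 * Cm * e ^ 3 / (1 - θ)) ∧ W 1 ∈ Set.Icc (3 / 4 : ℝ) (5 / 4) ∧ 0 < W 1 := by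
  have h := (tangent_one_sub_one_abs_le hB hCm hθ0 hθ1 hbs hta hts htf hprof hG h2e' hs1 hs2 hs4 hs5 he hW hWM).2
  obtain ⟨-, hlo, hhi⟩ := tangent_sub_one_abs_le hB hCm hθ0 hθ1 hbs hta hts htf hprof hG h2e' hs1 hs2 hs4 hs5 he hW hWM 1
  obtain ⟨h1, h2⟩ := abs_le.mp h
  exact ⟨⟨by linarith, by linarith⟩, ⟨hlo, hhi⟩, by linarith⟩

/-! ## §131 Tangent fields and the product formula -/

/-- **A TANGENT FIELD EXISTS**: under part 14's package at e′ and the gradient profile `hG` there is `Wf : ℝ → ℕ → ℝ` assigning to every pin `x ∈ ]0, e′]` the tangent flow at x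
(its equation along `solution B x` + `|Wf x| ≤ 2`) — part 68's `tangent_exists` and the axiom of choice; by `tangentField_eq` the field is unique on ]0, e′]. [folklore] -/
theorem tangentField_exists {B : (ℕ → ℝ) → ℝ} {G : (ℕ → ℝ) → ℕ → ℝ} {Cm θ γ bs ta gs e' : ℝ} {t : ℕ → ℝ}
    (hB : MemoryProfile Cm θ γ B) (hCm : 0 ≤ Cm) (hθ0 : 0 ≤ θ) (hθ1 : θ < 1) (hbs : 0 < bs) (hta : 0 < ta)
    (hts : SeqBox γ t) (htf : MemFlow B gs t) (hprof : ∀ m : ℕ, 1 / ta ^ 2 + bs * (m : ℝ) ≤ 1 / (t m) ^ 2)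
    (hG : ∀ u : ℕ → ℝ, SeqBox γ u → ∀ j, |G u j| ≤ Cm * θ ^ j)
    (h2e' : 2 * e' ≤ γ) (hs1 : 4 * Cm * e' ≤ bs * (1 - θ))
    (hs2 : e' ^ 2 * (1 / gs ^ 2 + Cm * γ / (1 - θ) ^ 2 + (2 * Cm / ((1 - θ) * bs)) ^ 2) ≤ 3 / 4)
    (hs4 : 64 * Cm * e' ^ 3 ≤ (1 - θ) ^ 2) (hs5 : Cm * (8 * e' ^ 3 + 16 * e' / bs) ≤ (1 - θ) / 4) :
    ∃ Wf : ℝ → ℕ → ℝ, ∀ x ∈ Ioc (0 : ℝ) e',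
      (∀ k, Wf x k = 1 - ∑ p ∈ range k, ∑' j, G (fun i => solution B x (p + 1 + i)) j * ((solution B x (p + 1 + j)) ^ 3 / 2) * Wf x (p + 1 + j)) ∧
      ∀ k, |Wf x k| ≤ 2 := by
  classical
  refine ⟨fun x => if hx : x ∈ Ioc (0 : ℝ) e' then
      Classical.choose (tangent_exists hB hCm hθ0 hθ1 hbs hta hts htf hprof hG h2e' hs1 hs2 hs4 hs5 hx) else fun _ => 0, fun x hx => ?_⟩
  simp only [dif_pos hx]
  exact Classical.choose_spec (tangent_exists hB hCm hθ0 hθ1 hbs hta hts htf hprof hG h2e' hs1 hs2 hs4 hs5 hx)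

/-- **THE TANGENT FIELD IS UNIQUE**: two tangent fields agree at every pin of ]0, e′] (part 68's `tangent_unique`). [folklore] -/
theorem tangentField_eq {B : (ℕ → ℝ) → ℝ} {G : (ℕ → ℝ) → ℕ → ℝ} {Cm θ γ bs ta gs e' : ℝ} {t : ℕ → ℝ}
    (hB : MemoryProfile Cm θ γ B) (hCm : 0 ≤ Cm) (hθ0 : 0 ≤ θ) (hθ1 : θ < 1) (hbs : 0 < bs) (hta : 0 < ta)
    (hts : SeqBox γ t) (htf : MemFlow B gs t) (hprof : ∀ m : ℕ, 1 / ta ^ 2 + bs * (m : ℝ) ≤ 1 / (t m) ^ 2)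
    (hG : ∀ u : ℕ → ℝ, SeqBox γ u → ∀ j, |G u j| ≤ Cm * θ ^ j)
    (h2e' : 2 * e' ≤ γ) (hs1 : 4 * Cm * e' ≤ bs * (1 - θ))
    (hs2 : e' ^ 2 * (1 / gs ^ 2 + Cm * γ / (1 - θ) ^ 2 + (2 * Cm / ((1 - θ) * bs)) ^ 2) ≤ 3 / 4)
    (hs4 : 64 * Cm * e' ^ 3 ≤ (1 - θ) ^ 2) (hs5 : Cm * (8 * e' ^ 3 + 16 * e' / bs) ≤ (1 - θ) / 4)
    {Wf Wf' : ℝ → ℕ → ℝ}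
    (hWf : ∀ x ∈ Ioc (0 : ℝ) e',
      (∀ k, Wf x k = 1 - ∑ p ∈ range k, ∑' j, G (fun i => solution B x (p + 1 + i)) j * ((solution B x (p + 1 + j)) ^ 3 / 2) * Wf x (p + 1 + j)) ∧
      ∀ k, |Wf x k| ≤ 2)
    (hWf' : ∀ x ∈ Ioc (0 : ℝ) e',
      (∀ k, Wf' x k = 1 - ∑ p ∈ range k, ∑' j, G (fun i => solution B x (p + 1 + i)) j * ((solution B x (p + 1 + j)) ^ 3 / 2) * Wf' x (p + 1 + j)) ∧
      ∀ k, |Wf' x k| ≤ 2) :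
    ∀ x ∈ Ioc (0 : ℝ) e', Wf x = Wf' x := fun x hx =>
  tangent_unique hB hCm hθ0 hθ1 hbs hta hts htf hprof hG h2e' hs1 hs2 hs4 hs5 hx (hWf x hx).1 (hWf x hx).2 (hWf' x hx).1 (hWf' x hx).2

/-- **THE PRODUCT FORMULA.**  Part 14's package at e′, the gradient profile `hG`, a tangent field Wf on ]0, e′], a pin `e ∈ ]0, e′]` with `2e ≤ e′` (so that the whole
trajectory `h = solution B e` stays in ]0, e′], part 75's `solution_tail_of_le_half`).  THEN at every scale k: **`W_k(e) = Π_{i<k} ω(h_i(e))`**, `ω(x) = Wf x 1` the one-step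
tangent factor — part 75's cocycle `W_{k+1}(e) = W_k(e)·Ŵ_1(h_k e)` with `Ŵ = Wf (h_k e)` the tangent flow along `solution B (h_k e) = (h_{k+j}(e))_j`, iterated.  The tangent
flow is the ordered product of the derivatives of the one-step chart maps along the ultraviolet trajectory — the chain rule of the renormalization group.
[cite: Balaban1987RG1, Thm 2 (0.31) p.259 with (0.20) p.256 and p.298] -/
theorem tangentField_eq_prod {B : (ℕ → ℝ) → ℝ} {G : (ℕ → ℝ) → ℕ → ℝ} {Cm θ γ bs ta gs e' : ℝ} {t : ℕ → ℝ}
    (hB : MemoryProfile Cm θ γ B) (hCm : 0 ≤ Cm) (hθ0 : 0 ≤ θ) (hθ1 : θ < 1) (hbs : 0 < bs) (hta : 0 < ta)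
    (hts : SeqBox γ t) (htf : MemFlow B gs t) (hprof : ∀ m : ℕ, 1 / ta ^ 2 + bs * (m : ℝ) ≤ 1 / (t m) ^ 2)
    (hG : ∀ u : ℕ → ℝ, SeqBox γ u → ∀ j, |G u j| ≤ Cm * θ ^ j)
    (h2e' : 2 * e' ≤ γ) (hs1 : 4 * Cm * e' ≤ bs * (1 - θ))
    (hs2 : e' ^ 2 * (1 / gs ^ 2 + Cm * γ / (1 - θ) ^ 2 + (2 * Cm / ((1 - θ) * bs)) ^ 2) ≤ 3 / 4)
    (hs4 : 64 * Cm * e' ^ 3 ≤ (1 - θ) ^ 2) (hs5 : Cm * (8 * e' ^ 3 + 16 * e' / bs) ≤ (1 - θ) / 4)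
    {Wf : ℝ → ℕ → ℝ}
    (hWf : ∀ x ∈ Ioc (0 : ℝ) e',
      (∀ k, Wf x k = 1 - ∑ p ∈ range k, ∑' j, G (fun i => solution B x (p + 1 + i)) j * ((solution B x (p + 1 + j)) ^ 3 / 2) * Wf x (p + 1 + j)) ∧
      ∀ k, |Wf x k| ≤ 2)
    {e : ℝ} (he : e ∈ Ioc (0 : ℝ) e') (h2e : 2 * e ≤ e') (k : ℕ) :
    Wf e k = ∏ i ∈ range k, Wf (solution B e i) 1 := by
  obtain ⟨hsb, -⟩ := solution_facts hB hCm hθ0 hθ1 hbs hta hts htf hprof h2e' hs1 hs2 hs4 hs5 he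
  induction k with
  | zero => rw [(hWf e he).1 0, Finset.sum_range_zero, Finset.prod_range_zero]; ring
  | succ k ih =>
    have hk : solution B e k ≤ e' := (solution_tail_of_le_half hB hCm hθ0 hθ1 hbs hta hts htf hprof h2e' hs1 hs2 hs4 hs5 he h2e k).1
    have hx : solution B e k ∈ Ioc (0 : ℝ) e' := ⟨(hsb k).1, hk⟩
    rw [Finset.prod_range_succ, ← ih]
    exact tangent_cocycle hB hCm hθ0 hθ1 hbs hta hts htf hprof hG h2e' hs1 hs2 hs4 hs5 he hk (hWf e he).1 (hWf e he).2
      (hWf _ hx).1 (hWf _ hx).2 1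

/-- **THE i-TH FACTOR AGAINST THE PIN's OWN WEIGHTS**: for `2e ≤ e′` and every scale i, **`|ω(h_i(e)) − 1| ≤ C_m·w_{i+1}(e)∕(1−θ)`**, `w_q(e) = (1∕(4e²) + (β*∕4)q)^{−3∕2}` —
the factor at the running coupling `h_i(e)` is row i of part 66's kernel along `solution B (h_i e) = (h_{i+j}(e))_j` (part 75), whose cubes are below e's AF weights from
scale i + 1 on (part 68's `solution_facts` at the slid package).  Summing over i recovers part 68's `|W_k − 1| ≤ C_m(8e³ + 16e∕β*)∕(1−θ)` factor by factor.
[cite: Balaban1987RG1, Thm 2 (0.31) p.259 with (0.20) p.256 and p.298] -/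
theorem tangentField_one_sub_one_abs_le {B : (ℕ → ℝ) → ℝ} {G : (ℕ → ℝ) → ℕ → ℝ} {Cm θ γ bs ta gs e' : ℝ} {t : ℕ → ℝ}
    (hB : MemoryProfile Cm θ γ B) (hCm : 0 ≤ Cm) (hθ0 : 0 ≤ θ) (hθ1 : θ < 1) (hbs : 0 < bs) (hta : 0 < ta)
    (hts : SeqBox γ t) (htf : MemFlow B gs t) (hprof : ∀ m : ℕ, 1 / ta ^ 2 + bs * (m : ℝ) ≤ 1 / (t m) ^ 2)
    (hG : ∀ u : ℕ → ℝ, SeqBox γ u → ∀ j, |G u j| ≤ Cm * θ ^ j)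
    (h2e' : 2 * e' ≤ γ) (hs1 : 4 * Cm * e' ≤ bs * (1 - θ))
    (hs2 : e' ^ 2 * (1 / gs ^ 2 + Cm * γ / (1 - θ) ^ 2 + (2 * Cm / ((1 - θ) * bs)) ^ 2) ≤ 3 / 4)
    (hs4 : 64 * Cm * e' ^ 3 ≤ (1 - θ) ^ 2) (hs5 : Cm * (8 * e' ^ 3 + 16 * e' / bs) ≤ (1 - θ) / 4)
    {Wf : ℝ → ℕ → ℝ}
    (hWf : ∀ x ∈ Ioc (0 : ℝ) e',
      (∀ k, Wf x k = 1 - ∑ p ∈ range k, ∑' j, G (fun i => solution B x (p + 1 + i)) j * ((solution B x (p + 1 + j)) ^ 3 / 2) * Wf x (p + 1 + j)) ∧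
      ∀ k, |Wf x k| ≤ 2)
    {e : ℝ} (he : e ∈ Ioc (0 : ℝ) e') (h2e : 2 * e ≤ e') (i : ℕ) :
    |Wf (solution B e i) 1 - 1| ≤ Cm * (1 / (sprof (2 * e) (bs / 4) (i + 1)) ^ 2 * (1 / sprof (2 * e) (bs / 4) (i + 1))) / (1 - θ) := by
  have h1θ : 0 < 1 - θ := by linarith
  have hγ : 0 ≤ γ := by linarith [he.1, he.2]
  -- the package at the pin e itself: the cubes of the solution are below e's own AF weights
  obtain ⟨hs1e, hs2e, hs4e, hs5e⟩ := package_of_le (gs := gs) hCm hθ1 hbs hγ he.1 he.2 hs1 hs2 hs4 hs5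
  have hee : e ∈ Ioc (0 : ℝ) e := ⟨he.1, le_rfl⟩
  have h2eγ : 2 * e ≤ γ := by linarith [he.2]
  obtain ⟨hsb, -, -, -, -, hcube⟩ := solution_facts hB hCm hθ0 hθ1 hbs hta hts htf hprof h2eγ hs1e hs2e hs4e hs5e hee
  obtain ⟨hk, htail⟩ := solution_tail_of_le_half hB hCm hθ0 hθ1 hbs hta hts htf hprof h2e' hs1 hs2 hs4 hs5 he h2e i
  have hx : solution B e i ∈ Ioc (0 : ℝ) e' := ⟨(hsb i).1, hk⟩
  obtain ⟨hWx, hWxM⟩ := hWf _ hx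
  obtain ⟨hsbx, -⟩ := solution_facts hB hCm hθ0 hθ1 hbs hta hts htf hprof h2e' hs1 hs2 hs4 hs5 hx
  -- the data of row 0 at the pin h_i(e), against the shifted weights w′_q = w_{i+q}(e)
  have hc : ∀ p j : ℕ, |G (fun l => solution B (solution B e i) (p + 1 + l)) j| ≤ Cm * θ ^ j := fun p j => hG _ (seqBox_shift hsbx (p + 1)) j
  have hv : ∀ q : ℕ, |(solution B (solution B e i) q) ^ 3 / 2|
      ≤ (fun q => 1 / (sprof (2 * e) (bs / 4) (i + q)) ^ 2 * (1 / sprof (2 * e) (bs / 4) (i + q))) q / 2 := by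
    intro q
    have hxq : solution B (solution B e i) q = solution B e (i + q) := congrFun htail q
    have hpos : 0 < solution B e (i + q) := (hsb (i + q)).1
    rw [hxq, abs_of_nonneg (by positivity)]
    have := hcube (i + q)
    simp only []
    linarith
  have hwanti : ∀ {a b : ℕ}, a ≤ b → (fun q => 1 / (sprof (2 * e) (bs / 4) (i + q)) ^ 2 * (1 / sprof (2 * e) (bs / 4) (i + q))) b
      ≤ (fun q => 1 / (sprof (2 * e) (bs / 4) (i + q)) ^ 2 * (1 / sprof (2 * e) (bs / 4) (i + q))) a :=
    fun {a b} hab => profWeight_anti hbs he.1 (by omega)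
  have hrow := (row_summable_abs_le hθ0 hθ1 hwanti (by norm_num : (0 : ℝ) ≤ 2 / 2) hCm 0 (abs_term_le hCm hθ0 hc hv hWxM 0)).2
  have e1 : Wf (solution B e i) 1 - 1 = -∑' j, G (fun l => solution B (solution B e i) (0 + 1 + l)) j
      * ((solution B (solution B e i) (0 + 1 + j)) ^ 3 / 2) * Wf (solution B e i) (0 + 1 + j) := by
    rw [hWx 1, Finset.sum_range_one]; ring
  rw [e1, abs_neg]
  refine hrow.trans (le_of_eq ?_)
  simp only [Nat.zero_add, div_self (two_ne_zero : (2 : ℝ) ≠ 0), mul_one]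

/-! ## §132 The infinite product and the discrete Gell-Mann–Low formula -/

/-- **THE INFINITE PRODUCT.**  Part 14's package at e′, `hG`, a tangent field Wf, `e ∈ ]0, e′]` with `2e ≤ e′`, and the ultraviolet limit `W_∞` of the tangent flow at e
(`W_k(e) → W_∞`, part 70).  THEN: the deviations `|ω(h_i e) − 1|` are SUMMABLE with **`Σ_i |ω(h_i(e)) − 1| ≤ C_m(8e³ + 16e∕β*)∕(1−θ)`** (§131 against the partial sums of the AF
weights, part 67); the factors are `Multipliable` (Mathlib's `multipliable_one_add_of_summable`); and **`HasProd (i ↦ ω(h_i(e))) W_∞`**, **`W_∞ = ∏' i, ω(h_i(e))`** (the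
product formula + uniqueness of limits).  The ultraviolet limit of the tangent flow is an absolutely convergent infinite product of one-step tangent factors.
[cite: Balaban1987RG1, Thm 2 (0.31) p.259 with (0.20) p.256 and p.298] -/
theorem hasProd_tangentField {B : (ℕ → ℝ) → ℝ} {G : (ℕ → ℝ) → ℕ → ℝ} {Cm θ γ bs ta gs e' : ℝ} {t : ℕ → ℝ}
    (hB : MemoryProfile Cm θ γ B) (hCm : 0 ≤ Cm) (hθ0 : 0 ≤ θ) (hθ1 : θ < 1) (hbs : 0 < bs) (hta : 0 < ta)
    (hts : SeqBox γ t) (htf : MemFlow B gs t) (hprof : ∀ m : ℕ, 1 / ta ^ 2 + bs * (m : ℝ) ≤ 1 / (t m) ^ 2)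
    (hG : ∀ u : ℕ → ℝ, SeqBox γ u → ∀ j, |G u j| ≤ Cm * θ ^ j)
    (h2e' : 2 * e' ≤ γ) (hs1 : 4 * Cm * e' ≤ bs * (1 - θ))
    (hs2 : e' ^ 2 * (1 / gs ^ 2 + Cm * γ / (1 - θ) ^ 2 + (2 * Cm / ((1 - θ) * bs)) ^ 2) ≤ 3 / 4)
    (hs4 : 64 * Cm * e' ^ 3 ≤ (1 - θ) ^ 2) (hs5 : Cm * (8 * e' ^ 3 + 16 * e' / bs) ≤ (1 - θ) / 4)
    {Wf : ℝ → ℕ → ℝ}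
    (hWf : ∀ x ∈ Ioc (0 : ℝ) e',
      (∀ k, Wf x k = 1 - ∑ p ∈ range k, ∑' j, G (fun i => solution B x (p + 1 + i)) j * ((solution B x (p + 1 + j)) ^ 3 / 2) * Wf x (p + 1 + j)) ∧
      ∀ k, |Wf x k| ≤ 2)
    {e : ℝ} (he : e ∈ Ioc (0 : ℝ) e') (h2e : 2 * e ≤ e') {Winf : ℝ} (hWinf : Tendsto (Wf e) atTop (𝓝 Winf)) :
    Summable (fun i => |Wf (solution B e i) 1 - 1|) ∧
      ∑' i, |Wf (solution B e i) 1 - 1| ≤ Cm * (8 * e ^ 3 + 16 * e / bs) / (1 - θ) ∧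
      Multipliable (fun i => Wf (solution B e i) 1) ∧ HasProd (fun i => Wf (solution B e i) 1) Winf ∧
      Winf = ∏' i, Wf (solution B e i) 1 := by
  have h1θ : 0 < 1 - θ := by linarith
  have hw0 : ∀ i : ℕ, 0 ≤ 1 / (sprof (2 * e) (bs / 4) (i + 1)) ^ 2 * (1 / sprof (2 * e) (bs / 4) (i + 1)) :=
    fun i => profWeight_nonneg hbs he.1 (i + 1)
  have hb : ∀ i : ℕ, |Wf (solution B e i) 1 - 1| ≤ Cm / (1 - θ) * (1 / (sprof (2 * e) (bs / 4) (i + 1)) ^ 2 * (1 / sprof (2 * e) (bs / 4) (i + 1))) := by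
    intro i
    have h := tangentField_one_sub_one_abs_le hB hCm hθ0 hθ1 hbs hta hts htf hprof hG h2e' hs1 hs2 hs4 hs5 hWf he h2e i
    calc |Wf (solution B e i) 1 - 1| ≤ Cm * (1 / (sprof (2 * e) (bs / 4) (i + 1)) ^ 2 * (1 / sprof (2 * e) (bs / 4) (i + 1))) / (1 - θ) := h
      _ = Cm / (1 - θ) * (1 / (sprof (2 * e) (bs / 4) (i + 1)) ^ 2 * (1 / sprof (2 * e) (bs / 4) (i + 1))) := by ring
  have hsw : Summable fun i : ℕ => 1 / (sprof (2 * e) (bs / 4) (i + 1)) ^ 2 * (1 / sprof (2 * e) (bs / 4) (i + 1)) :=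
    summable_of_sum_range_le hw0 (sum_profWeight_succ_le hbs he.1)
  have hsa : Summable fun i => |Wf (solution B e i) 1 - 1| :=
    Summable.of_nonneg_of_le (fun i => abs_nonneg _) hb (hsw.mul_left _)
  have htsum : ∑' i, |Wf (solution B e i) 1 - 1| ≤ Cm * (8 * e ^ 3 + 16 * e / bs) / (1 - θ) := by
    calc ∑' i, |Wf (solution B e i) 1 - 1|
        ≤ ∑' i : ℕ, Cm / (1 - θ) * (1 / (sprof (2 * e) (bs / 4) (i + 1)) ^ 2 * (1 / sprof (2 * e) (bs / 4) (i + 1))) := hsa.tsum_le_tsum hb (hsw.mul_left _)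
      _ = Cm / (1 - θ) * ∑' i : ℕ, 1 / (sprof (2 * e) (bs / 4) (i + 1)) ^ 2 * (1 / sprof (2 * e) (bs / 4) (i + 1)) := tsum_mul_left
      _ ≤ Cm / (1 - θ) * (8 * e ^ 3 + 16 * e / bs) :=
          mul_le_mul_of_nonneg_left (Real.tsum_le_of_sum_range_le hw0 (sum_profWeight_succ_le hbs he.1)) (by positivity)
      _ = Cm * (8 * e ^ 3 + 16 * e / bs) / (1 - θ) := by ring
  have hmult : Multipliable fun i => Wf (solution B e i) 1 := by
    have hn : Summable fun i => ‖Wf (solution B e i) 1 - 1‖ := by simpa only [Real.norm_eq_abs] using hsa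
    have h := multipliable_one_add_of_summable hn
    have h1 : (fun i => 1 + (Wf (solution B e i) 1 - 1)) = fun i => Wf (solution B e i) 1 := funext fun i => by ring
    rwa [h1] at h
  have hlim : Tendsto (fun k => ∏ i ∈ range k, Wf (solution B e i) 1) atTop (𝓝 (∏' i, Wf (solution B e i) 1)) := hmult.tendsto_prod_tprod_nat
  have hlim' : Tendsto (fun k => ∏ i ∈ range k, Wf (solution B e i) 1) atTop (𝓝 Winf) := by
    have hfun : (fun k => ∏ i ∈ range k, Wf (solution B e i) 1) = Wf e :=
      funext fun k => (tangentField_eq_prod hB hCm hθ0 hθ1 hbs hta hts htf hprof hG h2e' hs1 hs2 hs4 hs5 hWf he h2e k).symm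
    rw [hfun]; exact hWinf
  have heq : Winf = ∏' i, Wf (solution B e i) 1 := tendsto_nhds_unique hlim' hlim
  exact ⟨hsa, htsum, hmult, heq ▸ hmult.hasProd, heq⟩

/-- **THE DISCRETE GELL-MANN–LOW FORMULA.**  Part 14's package at e′; the C¹ letters `hG`, `hGB` of part 68; Λ ANY dynamical Abel function of the flow (part 44's interface);
a tangent field Wf; an interior pin `e ∈ ]0, e′[` with `2e ≤ e′`.  THEN **`Λ′(e) = −(2∕e³)·Π_{i≥0} ω(h_i(e))`** and **`HasProd (i ↦ ω(h_i(e))) ((−e³∕2)·Λ′(e))`**: part 70's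
`Λ′(e) = −2W_∞(e)∕e³` with `W_∞(e)` the infinite product of §132 — the derivative of the Λ-coordinate at a coupling is the chart slope `−2∕e³` times the product of the
derivatives of ALL the one-step chart maps along the ultraviolet trajectory from e. [cite: Balaban1987RG1, Thm 2 (0.31) p.259 with (0.20) p.256 and p.298] -/
theorem deriv_dynAbel_eq_tprod {B : (ℕ → ℝ) → ℝ} {G : (ℕ → ℝ) → ℕ → ℝ} {Cm θ γ bs ta gs e' : ℝ} {t : ℕ → ℝ} {a : ℕ → ℝ} {Λ : ℝ → ℝ}
    (hB : MemoryProfile Cm θ γ B) (hCm : 0 ≤ Cm) (hθ0 : 0 ≤ θ) (hθ1 : θ < 1) (hbs : 0 < bs) (hta : 0 < ta)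
    (hts : SeqBox γ t) (htf : MemFlow B gs t) (hprof : ∀ m : ℕ, 1 / ta ^ 2 + bs * (m : ℝ) ≤ 1 / (t m) ^ 2)
    (hG : ∀ u : ℕ → ℝ, SeqBox γ u → ∀ j, |G u j| ≤ Cm * θ ^ j)
    (hGB : ∀ ε > 0, ∃ ρ > 0, ∀ u u' : ℕ → ℝ, SeqBox γ u → SeqBox γ u' → (∀ j, |u' j - u j| ≤ ρ) →
      |B u' - B u - ∑' j, G u j * (u' j - u j)| ≤ ε * ∑' j, θ ^ j * |u' j - u j|)
    (hΛ : ∀ e ∈ Ioc (0 : ℝ) e', ∀ h : ℕ → ℝ, SeqBox γ h → MemFlow B e h → Tendsto (fun n => 1 / h n ^ 2 - a n) atTop (𝓝 (Λ e)))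
    (h2e' : 2 * e' ≤ γ) (hs1 : 4 * Cm * e' ≤ bs * (1 - θ))
    (hs2 : e' ^ 2 * (1 / gs ^ 2 + Cm * γ / (1 - θ) ^ 2 + (2 * Cm / ((1 - θ) * bs)) ^ 2) ≤ 3 / 4)
    (hs4 : 64 * Cm * e' ^ 3 ≤ (1 - θ) ^ 2) (hs5 : Cm * (8 * e' ^ 3 + 16 * e' / bs) ≤ (1 - θ) / 4)
    {Wf : ℝ → ℕ → ℝ}
    (hWf : ∀ x ∈ Ioc (0 : ℝ) e',
      (∀ k, Wf x k = 1 - ∑ p ∈ range k, ∑' j, G (fun i => solution B x (p + 1 + i)) j * ((solution B x (p + 1 + j)) ^ 3 / 2) * Wf x (p + 1 + j)) ∧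
      ∀ k, |Wf x k| ≤ 2)
    {e : ℝ} (he : e ∈ Ioo (0 : ℝ) e') (h2e : 2 * e ≤ e') :
    deriv Λ e = (∏' i, Wf (solution B e i) 1) * (-2 / e ^ 3) ∧ HasProd (fun i => Wf (solution B e i) 1) (-(e ^ 3) / 2 * deriv Λ e) ∧
      0 < ∏' i, Wf (solution B e i) 1 := by
  have hec : e ∈ Ioc (0 : ℝ) e' := ⟨he.1, he.2.le⟩
  obtain ⟨Winf, hWinf, -, -, hlo, -⟩ :=
    tangentLimit_exists hB hCm hθ0 hθ1 hbs hta hts htf hprof hG h2e' hs1 hs2 hs4 hs5 hec (hWf e hec).1 (hWf e hec).2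
  obtain ⟨hd, hWeq⟩ := deriv_dynAbel_eq hB hCm hθ0 hθ1 hbs hta hts htf hprof hG hGB hΛ h2e' hs1 hs2 hs4 hs5 he (hWf e hec).1 (hWf e hec).2 hWinf
  obtain ⟨-, -, -, hprod, heq⟩ := hasProd_tangentField hB hCm hθ0 hθ1 hbs hta hts htf hprof hG h2e' hs1 hs2 hs4 hs5 hWf hec h2e hWinf
  refine ⟨by rw [hd, heq], by rw [← hWeq]; exact hprod, ?_⟩
  rw [← heq]; linarith

/-- **THE CONTINUUM β-FUNCTION AS AN INFINITE PRODUCT** (parts 60 ∕ 72: `β_c = β₀∕Λ′`): at every interior pin with `2e ≤ e′`,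
**`β₀∕Λ′(e) = −(β₀e³∕2)·(Π_{i≥0} ω(h_i(e)))⁻¹`** — the bare one-loop value `−(β₀∕2)e³` corrected by the inverse product of the one-step tangent factors along the ultraviolet
trajectory from e (each factor `1 + O(h_i³)`, §130).  OUR READING; nothing of Bałaban's β is asserted. [cite: Balaban1987RG1, Thm 2 (0.31) p.259 with (0.20) p.256 and p.298] -/
theorem betaFunction_eq_tprod {B : (ℕ → ℝ) → ℝ} {G : (ℕ → ℝ) → ℕ → ℝ} {Cm θ γ β₀ bs ta gs e' : ℝ} {t : ℕ → ℝ} {a : ℕ → ℝ} {Λ : ℝ → ℝ}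
    (hB : MemoryProfile Cm θ γ B) (hCm : 0 ≤ Cm) (hθ0 : 0 ≤ θ) (hθ1 : θ < 1) (hbs : 0 < bs) (hta : 0 < ta)
    (hts : SeqBox γ t) (htf : MemFlow B gs t) (hprof : ∀ m : ℕ, 1 / ta ^ 2 + bs * (m : ℝ) ≤ 1 / (t m) ^ 2)
    (hG : ∀ u : ℕ → ℝ, SeqBox γ u → ∀ j, |G u j| ≤ Cm * θ ^ j)
    (hGB : ∀ ε > 0, ∃ ρ > 0, ∀ u u' : ℕ → ℝ, SeqBox γ u → SeqBox γ u' → (∀ j, |u' j - u j| ≤ ρ) →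
      |B u' - B u - ∑' j, G u j * (u' j - u j)| ≤ ε * ∑' j, θ ^ j * |u' j - u j|)
    (hΛ : ∀ e ∈ Ioc (0 : ℝ) e', ∀ h : ℕ → ℝ, SeqBox γ h → MemFlow B e h → Tendsto (fun n => 1 / h n ^ 2 - a n) atTop (𝓝 (Λ e)))
    (h2e' : 2 * e' ≤ γ) (hs1 : 4 * Cm * e' ≤ bs * (1 - θ))
    (hs2 : e' ^ 2 * (1 / gs ^ 2 + Cm * γ / (1 - θ) ^ 2 + (2 * Cm / ((1 - θ) * bs)) ^ 2) ≤ 3 / 4)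
    (hs4 : 64 * Cm * e' ^ 3 ≤ (1 - θ) ^ 2) (hs5 : Cm * (8 * e' ^ 3 + 16 * e' / bs) ≤ (1 - θ) / 4)
    {Wf : ℝ → ℕ → ℝ}
    (hWf : ∀ x ∈ Ioc (0 : ℝ) e',
      (∀ k, Wf x k = 1 - ∑ p ∈ range k, ∑' j, G (fun i => solution B x (p + 1 + i)) j * ((solution B x (p + 1 + j)) ^ 3 / 2) * Wf x (p + 1 + j)) ∧
      ∀ k, |Wf x k| ≤ 2)
    {e : ℝ} (he : e ∈ Ioo (0 : ℝ) e') (h2e : 2 * e ≤ e') :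
    β₀ / deriv Λ e = -(β₀ * e ^ 3 / 2) * (∏' i, Wf (solution B e i) 1)⁻¹ := by
  obtain ⟨hd, -, hpos⟩ := deriv_dynAbel_eq_tprod hB hCm hθ0 hθ1 hbs hta hts htf hprof hG hGB hΛ h2e' hs1 hs2 hs4 hs5 hWf he h2e
  have he3 : (0 : ℝ) < e ^ 3 := pow_pos he.1 3
  rw [hd]
  field_simp

end

end Summit.QuantumFields.BalabanUV.Beta.EriceFlowEnclosureB12AsPrintedHistoryContagionShiftFlowZeroTangentProduct
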